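import Summits.ResolutionOfSingularities.ResolutionOfSingularities.Theorems.FrobeniusLadderFRationalResolutionFixedPointContraction
import Mathlib.Algebra.Group.Submonoid.Finsupp
import HarnessLib

/-!
# Crux `FrobeniusLadder.FRationalResolution` (stmt-ResolutionOfSingularities-15317), line `redirect`,
# stub `stub_diagonalizableQuotientResolution` — on the invariant neighbourhood of a fixed point the
# graded pieces of OFF-SUPPORT degree are swallowed by the stratum ideal `(x_I)` (hypothesis `hzero`
# of `…GradedQuotientFree` for step (e-asm) of the plan, memo MEMO-15317-leafhand2-g3 §6–§7)

With `S_g = (S₀)_g[x]` (`…FixedPointMonomialNhd`: `g • S ⊆ S₀[x]`), a homogeneous element `s` of degree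
`c` satisfies `g s = Σ r_m x^m` over the monomials `x^m` of degree `c`
(`…FixedPointContraction.decompose_mem_span_monomials_of_mem_adjoin`). If `c` is NOT the degree of a
monomial supported on the complement `J` of `I`, every such monomial involves some `xᵢ`, `i ∈ I`, so
`g s ∈ (xᵢ : i ∈ I)`. Hence, after inverting `g`, the pieces of degree outside
`D_I = {Σ_{j ∉ I} m_j a_j}` lie in the stratum ideal `(x_I)` — while on the neighbourhood where the
`x_j`, `j ∉ I`, are units every degree in `D_I` carries a unit monomial: exactly the hypotheses of
`…GradedQuotientFree.flat_quotient`.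

* `monomial_mem_span_or_degree_mem` — a monomial `x^m` is `0`, or lies in `(x_I)`, or has degree in `D_I`;
* **`mul_mem_span_of_degree_not_mem`** — `c ∉ D_I`, `s ∈ S_c` ⇒ `g s ∈ (x_I)`;
* `isUnit_monomial_of_isUnit` — if the `x_j`, `j ∉ I`, are units then every degree in `D_I` carries a
  unit monomial supported off `I`.

Honest label: elementary brick (no stub closed). No definitions, no named facts, no sorry.
[folklore; cite: Kato1994, Def. (2.1)] [cite: SGA3, Exp. VIII §4–5]
-/

noncomputable section

-- single-problem summit: the doubled namespace component is forced
set_option linter.dupNamespace false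

open DirectSum

namespace Summit.ResolutionOfSingularities.ResolutionOfSingularities.Theorems.FRationalResolution.OffSupportDegrees

universe u w

variable {k : Type u} [Field k] {A : Type w} [DecidableEq A] [AddCommGroup A] {S : Type u}
  [CommRing S] [Algebra k S] (𝒮 : A → Submodule k S) [GradedAlgebra 𝒮]
  {n : ℕ} (x : Fin n → S) (a : Fin n → A) (hx : ∀ i, x i ∈ 𝒮 (a i))

include hx in
/-- **Trichotomy for monomials.** A monomial `μ` in homogeneous `x₁,…,x_n` of degree `c` is `0`, or
lies in the ideal `(xᵢ : i ∈ I)`, or `c = Σ_j m_j a_j` for exponents `m` vanishing on `I`. [folklore] -/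
theorem monomial_mem_span_or_degree_mem (I : Finset (Fin n)) {μ : S}
    (hμ : μ ∈ Submonoid.closure (Set.range x)) {c : A} (hμc : μ ∈ 𝒮 c) :
    μ = 0 ∨ μ ∈ Ideal.span (x '' (↑I : Set (Fin n))) ∨
      ∃ m : Fin n → ℕ, (∀ i ∈ I, m i = 0) ∧ ∑ i, m i • a i = c := by
  classical
  obtain ⟨m, rfl⟩ := (Submonoid.mem_closure_range_iff_of_fintype (f := x) (x := μ)).mp hμ
  by_cases h0 : ∏ i, x i ^ m i = 0
  · exact Or.inl h0
  by_cases hI : ∃ i ∈ I, m i ≠ 0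
  · obtain ⟨i, hiI, hmi⟩ := hI
    refine Or.inr (Or.inl ?_)
    -- `x i` divides the monomial
    have hdvd : x i ∣ ∏ j, x j ^ m j := by
      have h1 : x i ∣ x i ^ m i := dvd_pow_self (x i) hmi
      exact h1.trans (Finset.dvd_prod_of_mem (fun j => x j ^ m j) (Finset.mem_univ i))
    obtain ⟨y, hy⟩ := hdvd
    rw [hy]
    exact Ideal.mul_mem_right y _ (Ideal.subset_span ⟨i, hiI, rfl⟩)
  · push Not at hI
    refine Or.inr (Or.inr ⟨m, hI, ?_⟩)
    have hdeg : ∏ i, x i ^ m i ∈ 𝒮 (∑ i, m i • a i) :=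
      SetLike.prod_pow_mem_graded 𝒮 (F := Finset.univ) (i := a) (g := x) m fun i _ => hx i
    exact (DirectSum.degree_eq_of_mem_mem 𝒮 hdeg hμc h0)

include hx in
/-- **Off-support degrees are swallowed by the stratum ideal.** If `g • S ⊆ S₀[x₁,…,x_n]` (`g ∈ S₀`)
and `c` is not of the form `Σ_{j ∉ I} m_j a_j`, then `g s ∈ (xᵢ : i ∈ I)` for every `s ∈ S_c`.
[folklore; cite: Kato1994, Def. (2.1)] -/
theorem mul_mem_span_of_degree_not_mem (I : Finset (Fin n)) (g : 𝒮 0)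
    (hgen : ∀ s : S, (g : S) * s ∈ Algebra.adjoin (𝒮 0) (Set.range x)) (c : A)
    (hc : ¬ ∃ m : Fin n → ℕ, (∀ i ∈ I, m i = 0) ∧ ∑ i, m i • a i = c) (s : S) (hs : s ∈ 𝒮 c) :
    (g : S) * s ∈ Ideal.span (x '' (↑I : Set (Fin n))) := by
  classical
  have hgs : (g : S) * s ∈ 𝒮 c := by
    have h := SetLike.mul_mem_graded g.2 hs
    rwa [zero_add] at h
  have hdec := FixedPointContraction.decompose_mem_span_monomials_of_mem_adjoin 𝒮 x a hx (hgen s) c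
  rw [decompose_of_mem_same 𝒮 hgs] at hdec
  -- the spanning monomials lie in the ideal
  have hsub : ((Submonoid.closure (Set.range x) : Set S) ∩ (𝒮 c : Set S)) ⊆
      ((Ideal.span (x '' (↑I : Set (Fin n)))).restrictScalars (𝒮 0) : Set S) := by
    rintro μ ⟨hμ, hμc⟩
    rcases monomial_mem_span_or_degree_mem 𝒮 x a hx I hμ hμc with h | h | h
    · rw [h]; exact Submodule.zero_mem _
    · exact h
    · exact (hc h).elim
  exact (Submodule.span_le.mpr hsub) hdec

include hx in
/-- **Unit monomials on the support degrees.** If the `x_j`, `j ∉ I`, are units of `S`, then every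
degree `c = Σ_j m_j a_j` with `m` vanishing on `I` carries a homogeneous unit, namely the monomial
`∏ x_j^{m_j}`. [folklore; cite: SGA3, Exp. VIII §4–5] -/
theorem isUnit_monomial_of_isUnit (I : Finset (Fin n)) (hunit : ∀ j ∉ I, IsUnit (x j))
    (m : Fin n → ℕ) (hm : ∀ i ∈ I, m i = 0) :
    IsUnit (∏ i, x i ^ m i) ∧ ∏ i, x i ^ m i ∈ 𝒮 (∑ i, m i • a i) := by
  refine ⟨?_, SetLike.prod_pow_mem_graded 𝒮 (F := Finset.univ) (i := a) (g := x) m fun i _ => hx i⟩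
  refine IsUnit.prod_univ_iff.mpr fun i => ?_
  by_cases hi : i ∈ I
  · rw [hm i hi, pow_zero]; exact isUnit_one
  · exact (hunit i hi).pow _

end Summit.ResolutionOfSingularities.ResolutionOfSingularities.Theorems.FRationalResolution.OffSupportDegrees

end
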